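import Literature.Analysis.OperatorTheory.KernelIterateBridge
import Literature.MathematicalPhysics.KineticTheory.InfiniteChainTransferPeeling
import Literature.MathematicalPhysics.KineticTheory.InfiniteChainMarkovSuperstable
import HarnessLib

/-!
# From `ℝ≥0∞` marginal integrals to real transfer-operator iterates: the bridge lemmas

Topic `Literature/MathematicalPhysics/KineticTheory`; theorems only (no definitions, no named
facts). The finite-volume Gibbs distributions of the chain are ratios of `ℝ≥0∞`-valued marginal
integrals against Lebesgue measure (`InfiniteChainSpecificationDensity.lean`), peeled in
`InfiniteChainTransferPeeling.lean` / `InfiniteChainIntervalPeel.lean` to iterates of the `ℝ≥0∞`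
transfer step `(κ' F)(x) = ∫⁻ k(x,y) w(y) F(y) dy`; the spectral theory of the transfer operator
(`Literature.Analysis.OperatorTheory.exists_kernelRatio_tendsto_uniformly`) speaks about REAL iterates
`(κ f)(x) = ∫ K(x,y) f(y) dρ(y)` against the finite one-site measure `ρ = w · Lebesgue`. This file
proves the dictionary between the two (`k = ofReal ∘ K`):

* `lintegral_weight_mul_ofReal` — `∫⁻ w · ofReal g d(Leb) = ofReal (∫ g dρ)` for bounded
  measurable `g ≥ 0`;
* `transferStep_iterate_ofReal` — `κ'^N (ofReal ∘ f) = ofReal ∘ κ^N f`, and `κ^N f` stays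
  measurable, non-negative and bounded;
* `windowKernel_le`, `windowKernel_pos`, `measurable_windowKernel` — the window kernel
  `m_Φ(x, y) = ∫⋯∫⁻_{a,…,a+n-1} Φ · (path weight from a-1) · k(σ_{a+n-1}, σ_{a+n})` of
  `lmarginal_interval_eq_iterate` is bounded by `(∫⁻ w)^n` (`Φ, k ≤ 1`), strictly positive for
  `Φ ≠ 0` (`w, k > 0`), and jointly measurable in `(x, y)`.

[folklore]
-/

noncomputable section

open MeasureTheory Set Function Finset Filter Literature.Probability.LatticeModels
  Literature.Analysis.OperatorTheory
open scoped ENNReal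

namespace Literature.MathematicalPhysics.KineticTheory.HeatConduction

/-! ### Real versus `ℝ≥0∞` integrals against the weighted measure -/

section Bridge

variable {Y : Type*} [MeasurableSpace Y] {ν : Measure Y} {w : Y → ℝ≥0∞} {K : Y → Y → ℝ} {C : ℝ}

/-- `∫⁻ w · ofReal g dν = ofReal (∫ g d(ν.withDensity w))` for a bounded measurable `g ≥ 0` and a
finite weighted measure. [folklore] -/
theorem lintegral_weight_mul_ofReal [IsFiniteMeasure (ν.withDensity w)] (hw : Measurable w)
    {g : Y → ℝ} (hg : Measurable g) (hg0 : ∀ y, 0 ≤ g y) {B : ℝ} (hgb : ∀ y, g y ≤ B) :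
    ∫⁻ y, w y * ENNReal.ofReal (g y) ∂ν = ENNReal.ofReal (∫ y, g y ∂ν.withDensity w) := by
  have hint : Integrable g (ν.withDensity w) :=
    memLp_one_iff_integrable.1 (MemLp.of_bound hg.aestronglyMeasurable B
      (Eventually.of_forall fun y => by rw [Real.norm_eq_abs, abs_of_nonneg (hg0 y)]; exact hgb y))
  rw [ofReal_integral_eq_lintegral_ofReal hint (Eventually.of_forall hg0),
    lintegral_withDensity_eq_lintegral_mul _ hw hg.ennreal_ofReal]
  rfl

/-- **`κ'^N (ofReal ∘ f) = ofReal ∘ κ^N f`.** For a jointly measurable real kernel `0 ≤ K ≤ C`, the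
`ℝ≥0∞` transfer step `κ' F = ∫⁻ ofReal K(·,y) w(y) F(y) dν` and the real one
`κ f = ∫ K(·,y) f(y) d(ν.withDensity w)` agree on bounded measurable `f ≥ 0` after all iterations,
and the real iterates stay measurable, non-negative and bounded. [folklore] -/
theorem transferStep_iterate_ofReal [IsFiniteMeasure (ν.withDensity w)] (hw : Measurable w)
    (hK : StronglyMeasurable (uncurry K)) (hC : ∀ x y, ‖K x y‖ ≤ C) (hK0 : ∀ x y, 0 ≤ K x y)
    {f : Y → ℝ} (hf : Measurable f) (hf0 : ∀ y, 0 ≤ f y) (hfb : ∃ B, ∀ y, ‖f y‖ ≤ B) (N : ℕ) :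
    (fun F : Y → ℝ≥0∞ => fun x => ∫⁻ y, ENNReal.ofReal (K x y) * w y * F y ∂ν)^[N]
        (fun y => ENNReal.ofReal (f y)) =
      (fun x => ENNReal.ofReal (((fun g : Y → ℝ => fun x => ∫ y, K x y * g y ∂ν.withDensity w)^[N]
        f) x)) ∧
      Measurable ((fun g : Y → ℝ => fun x => ∫ y, K x y * g y ∂ν.withDensity w)^[N] f) ∧
      (∀ x, 0 ≤ ((fun g : Y → ℝ => fun x => ∫ y, K x y * g y ∂ν.withDensity w)^[N] f) x) ∧
      ∃ B, ∀ x, ‖((fun g : Y → ℝ => fun x => ∫ y, K x y * g y ∂ν.withDensity w)^[N] f) x‖ ≤ B := by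
  induction N generalizing f with
  | zero => exact ⟨rfl, hf, hf0, hfb⟩
  | succ N ih =>
    -- one real step applied to `f`
    set κf : Y → ℝ := fun x => ∫ y, K x y * f y ∂ν.withDensity w with hκf
    obtain ⟨⟨B1, hB1⟩, hsm1⟩ := exists_bound_and_measurable_kernelIterate (μ := ν.withDensity w)
      hK hC hf hfb 1
    have hκfm : Measurable κf := hsm1.measurable
    have hκf0 : ∀ x, 0 ≤ κf x := fun x =>
      integral_nonneg fun y => mul_nonneg (hK0 x y) (hf0 y)
    have hκfb : ∃ B, ∀ x, ‖κf x‖ ≤ B := ⟨B1, hB1⟩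
    obtain ⟨h1, h2, h3, h4⟩ := ih hκfm hκf0 hκfb
    obtain ⟨B, hB⟩ := hfb
    have hstep : (fun x => ∫⁻ y, ENNReal.ofReal (K x y) * w y * ENNReal.ofReal (f y) ∂ν) =
        fun x => ENNReal.ofReal (κf x) := by
      funext x
      have hg : Measurable fun y => K x y * f y := (hK.measurable.of_uncurry_left).mul hf
      have hgb : ∀ y, K x y * f y ≤ C * B := fun y =>
        mul_le_mul ((le_abs_self _).trans ((Real.norm_eq_abs _).symm.le.trans (hC x y)))
          ((le_abs_self _).trans ((Real.norm_eq_abs _).symm.le.trans (hB y))) (hf0 y)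
          ((norm_nonneg _).trans (hC x y))
      rw [← lintegral_weight_mul_ofReal hw hg (fun y => mul_nonneg (hK0 x y) (hf0 y)) hgb]
      refine lintegral_congr fun y => ?_
      rw [ENNReal.ofReal_mul (hK0 x y)]
      ring
    refine ⟨?_, ?_, ?_, ?_⟩
    · rw [Function.iterate_succ_apply, Function.iterate_succ_apply, hstep, h1]
    · rw [Function.iterate_succ_apply]; exact h2
    · rw [Function.iterate_succ_apply]; exact h3
    · rw [Function.iterate_succ_apply]; exact h4

end Bridge

/-! ### The window kernel -/

section Window

variable {k : ℝ × ℝ → ℝ × ℝ → ℝ≥0∞} {w : ℝ × ℝ → ℝ≥0∞}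

/-- **The window kernel is bounded by `(∫⁻ w)^n`** when the observable and the bond kernel are
bounded by `1`. [folklore] -/
theorem windowKernel_le (hw : Measurable w) (hk1 : ∀ z z', k z z' ≤ 1)
    {Φ : ChainConfig → ℝ≥0∞} (hΦ1 : ∀ σ, Φ σ ≤ 1) (a : ℤ) (n : ℕ) (τ : ChainConfig) :
    (∫⋯∫⁻_Finset.Icc a (a + n - 1), (fun σ => Φ σ *
        ((∏ i ∈ Finset.range n, k (σ (a - 1 + i)) (σ (a - 1 + i + 1)) * w (σ (a - 1 + i + 1))) *
          k (σ (a + n - 1)) (σ (a + n)))) ∂fun _ : ℤ => (volume : Measure (ℝ × ℝ))) τ ≤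
      (∫⁻ z, w z) ^ n := by
  have hle : ∀ σ : ChainConfig, Φ σ *
      ((∏ i ∈ Finset.range n, k (σ (a - 1 + i)) (σ (a - 1 + i + 1)) * w (σ (a - 1 + i + 1))) *
        k (σ (a + n - 1)) (σ (a + n))) ≤ ∏ j ∈ Finset.range n, w (σ (a + j)) := by
    intro σ
    calc Φ σ * ((∏ i ∈ Finset.range n, k (σ (a - 1 + i)) (σ (a - 1 + i + 1)) * w (σ (a - 1 + i + 1))) *
          k (σ (a + n - 1)) (σ (a + n)))
        ≤ 1 * ((∏ i ∈ Finset.range n, (1 * w (σ (a - 1 + i + 1)))) * 1) := by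
          gcongr
          · exact hΦ1 σ
          · exact hk1 _ _
          · exact hk1 _ _
      _ = ∏ j ∈ Finset.range n, w (σ (a + j)) := by
          rw [one_mul, mul_one]
          refine Finset.prod_congr rfl fun j _ => ?_
          rw [one_mul, show a - 1 + (j : ℤ) + 1 = a + j by ring]
  refine (lmarginal_mono hle τ).trans ?_
  cases n with
  | zero =>
    have hI : Finset.Icc a (a + ((0 : ℕ) : ℤ) - 1) = ∅ := by
      ext i; simp only [Finset.mem_Icc, Finset.notMem_empty, iff_false]; push_cast; omega
    rw [hI, lmarginal_empty]
    simp
  | succ m =>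
    have hI : Finset.Icc a (a + ((m + 1 : ℕ) : ℤ) - 1) = Finset.Icc a (a + m) := by
      congr 1; push_cast; ring
    rw [hI, OscillatorChain.lmarginal_prod_range hw a m τ]

/-- **The window kernel of a nowhere-vanishing observable is strictly positive** (`w, k > 0`; used
for the observable `1`, i.e. for the normaliser). [folklore] -/
theorem windowKernel_pos (hw : Measurable w) (hk : Measurable (uncurry k))
    (hw0 : ∀ z, 0 < w z) (hk0 : ∀ z z', 0 < k z z') {Φ : ChainConfig → ℝ≥0∞} (hΦ : Measurable Φ)
    (hΦ0 : ∀ σ, Φ σ ≠ 0) (a : ℤ) (n : ℕ) (τ : ChainConfig) :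
    0 < (∫⋯∫⁻_Finset.Icc a (a + n - 1), (fun σ => Φ σ *
        ((∏ i ∈ Finset.range n, k (σ (a - 1 + i)) (σ (a - 1 + i + 1)) * w (σ (a - 1 + i + 1))) *
          k (σ (a + n - 1)) (σ (a + n)))) ∂fun _ : ℤ => (volume : Measure (ℝ × ℝ))) τ := by
  have hmeas : Measurable fun σ : ChainConfig => Φ σ *
      ((∏ i ∈ Finset.range n, k (σ (a - 1 + i)) (σ (a - 1 + i + 1)) * w (σ (a - 1 + i + 1))) *
        k (σ (a + n - 1)) (σ (a + n))) :=
    hΦ.mul ((measurable_pathWeight hk hw _ _).mul (measurable_kernel_eval hk _ _))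
  have hpos : ∀ σ : ChainConfig, Φ σ *
      ((∏ i ∈ Finset.range n, k (σ (a - 1 + i)) (σ (a - 1 + i + 1)) * w (σ (a - 1 + i + 1))) *
        k (σ (a + n - 1)) (σ (a + n))) ≠ 0 := fun σ => by
    refine mul_ne_zero (hΦ0 σ) (mul_ne_zero (Finset.prod_ne_zero_iff.2 fun i _ =>
      mul_ne_zero (hk0 _ _).ne' (hw0 _).ne') (hk0 _ _).ne')
  unfold lmarginal
  have hm : Measurable fun ζ : ↥(Finset.Icc a (a + n - 1)) → ℝ × ℝ => (fun σ : ChainConfig => Φ σ *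
      ((∏ i ∈ Finset.range n, k (σ (a - 1 + i)) (σ (a - 1 + i + 1)) * w (σ (a - 1 + i + 1))) *
        k (σ (a + n - 1)) (σ (a + n)))) (Function.updateFinset τ _ ζ) :=
    hmeas.comp measurable_updateFinset
  refine (lintegral_pos_iff_support hm).2 ?_
  have hsupp : support (fun ζ : ↥(Finset.Icc a (a + n - 1)) → ℝ × ℝ => (fun σ : ChainConfig => Φ σ *
      ((∏ i ∈ Finset.range n, k (σ (a - 1 + i)) (σ (a - 1 + i + 1)) * w (σ (a - 1 + i + 1))) *
        k (σ (a + n - 1)) (σ (a + n)))) (Function.updateFinset τ _ ζ)) = Set.univ :=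
    eq_univ_of_forall fun ζ => hpos _
  rw [hsupp, Measure.pi_univ]
  refine pos_iff_ne_zero.2 (Finset.prod_ne_zero_iff.2 fun i _ => ?_)
  exact (isOpen_univ.measure_pos (volume : Measure (ℝ × ℝ)) Set.univ_nonempty).ne'

/-- **The window kernel is jointly measurable** in the pair (left boundary spin, last window spin).
[folklore] -/
theorem measurable_windowKernel (hw : Measurable w) (hk : Measurable (uncurry k))
    {Φ : ChainConfig → ℝ≥0∞} (hΦ : Measurable Φ) (a : ℤ) (n : ℕ) (η₀ : ChainConfig) :
    Measurable fun p : (ℝ × ℝ) × (ℝ × ℝ) =>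
      (∫⋯∫⁻_Finset.Icc a (a + n - 1), (fun σ => Φ σ *
        ((∏ i ∈ Finset.range n, k (σ (a - 1 + i)) (σ (a - 1 + i + 1)) * w (σ (a - 1 + i + 1))) *
          k (σ (a + n - 1)) (σ (a + n)))) ∂fun _ : ℤ => (volume : Measure (ℝ × ℝ)))
        (Function.update (Function.update η₀ (a - 1) p.1) (a + n) p.2) := by
  have hmeas : Measurable fun σ : ChainConfig => Φ σ *
      ((∏ i ∈ Finset.range n, k (σ (a - 1 + i)) (σ (a - 1 + i + 1)) * w (σ (a - 1 + i + 1))) *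
        k (σ (a + n - 1)) (σ (a + n))) :=
    hΦ.mul ((measurable_pathWeight hk hw _ _).mul (measurable_kernel_eval hk _ _))
  have hcfg : Measurable fun p : (ℝ × ℝ) × (ℝ × ℝ) =>
      Function.update (Function.update η₀ (a - 1) p.1) (a + n) p.2 := by
    have h1 : Measurable fun p : (ℝ × ℝ) × (ℝ × ℝ) => (Function.update η₀ (a - 1) p.1, p.2) :=
      ((measurable_update η₀).comp measurable_fst).prodMk measurable_snd
    exact measurable_update'.comp h1
  exact (Measurable.lmarginal (fun _ : ℤ => (volume : Measure (ℝ × ℝ))) hmeas).comp hcfg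

end Window

end Literature.MathematicalPhysics.KineticTheory.HeatConduction

end
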